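import Summits.CriticalPhenomena.PercolationContinuityZ3.Theses.PercTiltedBlockers
import Literature.Probability.Percolation.SharpnessDCTProofs

/-!
# Tilt gluing for lattice configurations (route PercTiltedBlockers, item stmt-CriticalPhenomena-6394)

The route's support item `TiltGluing` quantifies over ALL bond configurations
`ω : BondConfig (Site 3) = Set (Sym2 (Site 3))`; since the tree's open graph
`openGraph ω = SimpleGraph.fromEdgeSet ω` is not intersected with the edge set of `ℤ³`, the item is
false as stated (see `PercTiltedBlockersTiltGluingRefutation.lean`: one non-lattice open pair jumps
from the bottom face to the top face).  This file proves the REPAIRED statement, with the side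
condition `ω ⊆ (zdGraph 3).edgeSet` (which holds `P_p`-almost surely, Mathlib's
`ProbabilityTheory.setBernoulli_ae_subset`, cf. `DCT16.real_mono_of_forall_subset_edgeSet`), which
is what the squaring step `TiltSquaring` actually consumes.

**Tilt gluing lemma** (deterministic).  `R = [0,h]×[0,L]×[0,M]`, `R' = [0,h]×[δ,L+δ]×[0,M]`,
`U = [0,h]×[0,L+δ]×[0,M]`, `δ ≤ L`, level `a`.  If no open path inside `R` joins
`{x₀ = 0} ∪ {x₁ = L, x₀ < a}` to `{x₀ = h} ∪ {x₁ = δ, x₀ ≥ a}`, and no open path inside `R'` joins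
`{x₀ = 0} ∪ {x₁ = δ, x₀ < a}` to `{x₀ = h} ∪ {x₁ = L, x₀ ≥ a}`, then no open path inside `U` joins
`{x₀ = 0}` to `{x₀ = h}`.

Proof: along an open path in `U` started on the bottom face propagate the invariant
"`v ∈ R ⇒ v` is reached inside `R` from `R`'s source set, and `v ∈ R' ⇒ v` is reached inside `R'`
from `R'`'s source set": a lattice step entering `R` from `U ∖ R` lands on the plane `x₁ = L`,
whose low part is in `R`'s source set and whose high part is in `R'`'s target set (excluded by the
`R'`-invariant and the second hypothesis); symmetrically for `R'` through the plane `x₁ = δ`.  The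
endpoint on the top face lies in a target set.  No cutsets, walls or path intersections are used.
-/

namespace Summit.CriticalPhenomena.PercolationContinuityZ3.Theorems

open Literature.Probability.Percolation Literature.Probability.LatticeModels

/-- Coordinates of `ℤ³`-neighbours differ by at most one. [folklore] -/
private theorem tiltGluing_adj_apply_le {u v : Site 3} (huv : (zdGraph 3).Adj u v) (j : Fin 3) :
    v j ≤ u j + 1 ∧ u j ≤ v j + 1 := by
  obtain ⟨i, hi | hi⟩ := (zdGraph_adj_iff u v).1 huv
  · rw [hi, Pi.add_apply, Pi.single_apply]
    split_ifs <;> omega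
  · rw [hi, Pi.add_apply, Pi.single_apply]
    split_ifs <;> omega

/-- Membership in an order box of `ℤ³`, coordinatewise. [folklore] -/
private theorem tiltGluing_mem_Icc {lo hi v : Site 3} :
    v ∈ Finset.Icc lo hi ↔
      (lo 0 ≤ v 0 ∧ lo 1 ≤ v 1 ∧ lo 2 ≤ v 2) ∧ (v 0 ≤ hi 0 ∧ v 1 ≤ hi 1 ∧ v 2 ≤ hi 2) := by
  rw [Finset.mem_Icc]
  constructor
  · rintro ⟨h1, h2⟩
    exact ⟨⟨h1 0, h1 1, h1 2⟩, ⟨h2 0, h2 1, h2 2⟩⟩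
  · rintro ⟨⟨h0, h1, h2⟩, ⟨h0', h1', h2'⟩⟩
    refine ⟨fun i => ?_, fun i => ?_⟩ <;> fin_cases i <;> assumption

/-- The box `R = [0,h]×[0,L]×[0,M]` in coordinates. [folklore] -/
private theorem tiltGluing_mem_R {h L M : ℕ} {v : Site 3} :
    v ∈ Finset.Icc (0 : Site 3) ![(h : ℤ), L, M] ↔
      (0 ≤ v 0 ∧ 0 ≤ v 1 ∧ 0 ≤ v 2) ∧ (v 0 ≤ h ∧ v 1 ≤ L ∧ v 2 ≤ M) := by
  rw [tiltGluing_mem_Icc]; simp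

/-- The box `R' = [0,h]×[δ,L+δ]×[0,M]` in coordinates. [folklore] -/
private theorem tiltGluing_mem_R' {h L M δ : ℕ} {v : Site 3} :
    v ∈ Finset.Icc (![0, (δ : ℤ), 0] : Site 3) ![(h : ℤ), L + δ, M] ↔
      (0 ≤ v 0 ∧ (δ : ℤ) ≤ v 1 ∧ 0 ≤ v 2) ∧ (v 0 ≤ h ∧ v 1 ≤ L + δ ∧ v 2 ≤ M) := by
  rw [tiltGluing_mem_Icc]; simp

/-- The box `U = [0,h]×[0,L+δ]×[0,M]` in coordinates. [folklore] -/
private theorem tiltGluing_mem_U {h L M δ : ℕ} {v : Site 3} :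
    v ∈ Finset.Icc (0 : Site 3) ![(h : ℤ), L + δ, M] ↔
      (0 ≤ v 0 ∧ 0 ≤ v 1 ∧ 0 ≤ v 2) ∧ (v 0 ≤ h ∧ v 1 ≤ L + δ ∧ v 2 ≤ M) := by
  rw [tiltGluing_mem_Icc]; simp

/-- Extending an open connection inside `S` by one open edge ending in `S`. [folklore] -/
private theorem tiltGluing_extend {ω : BondConfig (Site 3)} {S : Set (Site 3)} {s u v : Site 3}
    (hsu : ω ∈ openConnIn S s u) (huv : (openGraph ω).Adj u v) (hv : v ∈ S) :
    ω ∈ openConnIn S s v :=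
  DCT16.mem_openConnIn_of_pathIn ((DCT16.pathIn_of_mem_openConnIn hsu).tail huv hv)

/-- **Tilt gluing lemma, repaired form of `PercTiltedBlockers.TiltGluing`** (the route item with
the side condition `ω ⊆ (zdGraph 3).edgeSet` added after `∀ ω`; deterministic, every lattice
configuration): for `δ ≤ L`, if `R = Icc 0 (h,L,M)` has no open path inside it from
`{x₀ = 0} ∪ {x₁ = L, x₀ < a}` to `{x₀ = h} ∪ {x₁ = δ, a ≤ x₀}` and `R' = Icc (0,δ,0) (h,L+δ,M)` has
no open path inside it from `{x₀ = 0} ∪ {x₁ = δ, x₀ < a}` to `{x₀ = h} ∪ {x₁ = L, a ≤ x₀}`, then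
`U = Icc 0 (h,L+δ,M)` has no open path inside it from `{x₀ = 0}` to `{x₀ = h}`.  Proof by the
open-reach invariant described in the module docstring. [folklore] -/
theorem tiltGluing_of_subset_edgeSet : ∀ (h L M δ a : ℕ), δ ≤ L →
    ∀ ω : BondConfig (Site 3), ω ⊆ (zdGraph 3).edgeSet →
    (¬ ∃ x ∈ Finset.Icc (0 : Site 3) ![(h : ℤ), L, M], ∃ y ∈ Finset.Icc (0 : Site 3) ![(h : ℤ), L, M],
        (x 0 = 0 ∨ (x 1 = L ∧ x 0 < a)) ∧ (y 0 = h ∨ (y 1 = δ ∧ (a : ℤ) ≤ y 0)) ∧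
        ω ∈ openConnIn ↑(Finset.Icc (0 : Site 3) ![(h : ℤ), L, M]) x y) →
    (¬ ∃ x ∈ Finset.Icc (![0, (δ : ℤ), 0] : Site 3) ![(h : ℤ), L + δ, M],
        ∃ y ∈ Finset.Icc (![0, (δ : ℤ), 0] : Site 3) ![(h : ℤ), L + δ, M],
        (x 0 = 0 ∨ (x 1 = δ ∧ x 0 < a)) ∧ (y 0 = h ∨ (y 1 = L ∧ (a : ℤ) ≤ y 0)) ∧
        ω ∈ openConnIn ↑(Finset.Icc (![0, (δ : ℤ), 0] : Site 3) ![(h : ℤ), L + δ, M]) x y) →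
    ¬ ∃ x ∈ Finset.Icc (0 : Site 3) ![(h : ℤ), L + δ, M],
        ∃ y ∈ Finset.Icc (0 : Site 3) ![(h : ℤ), L + δ, M],
        x 0 = 0 ∧ y 0 = h ∧ ω ∈ openConnIn ↑(Finset.Icc (0 : Site 3) ![(h : ℤ), L + δ, M]) x y := by
  intro h L M δ a hδL ω hω hR hR'
  rintro ⟨x, hxU, y, hyU, hx0, hyh, hconn⟩
  have hδL' : (δ : ℤ) ≤ L := by exact_mod_cast hδL
  -- the open path inside `U`
  have hp : PathIn (openGraph ω) (↑(Finset.Icc (0 : Site 3) ![(h : ℤ), L + δ, M])) x y :=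
    DCT16.pathIn_of_mem_openConnIn hconn
  -- the invariant, propagated along the path
  have key := DCT16.pathIn_induction
    (fun v : Site 3 =>
      (v ∈ Finset.Icc (0 : Site 3) ![(h : ℤ), L, M] →
        ∃ s : Site 3, (s 0 = 0 ∨ (s 1 = (L : ℤ) ∧ s 0 < (a : ℤ))) ∧
          ω ∈ openConnIn ↑(Finset.Icc (0 : Site 3) ![(h : ℤ), L, M]) s v) ∧
      (v ∈ Finset.Icc (![0, (δ : ℤ), 0] : Site 3) ![(h : ℤ), L + δ, M] →
        ∃ s : Site 3, (s 0 = 0 ∨ (s 1 = (δ : ℤ) ∧ s 0 < (a : ℤ))) ∧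
          ω ∈ openConnIn ↑(Finset.Icc (![0, (δ : ℤ), 0] : Site 3) ![(h : ℤ), L + δ, M]) s v))
    hp
    ⟨fun hxR => ⟨x, Or.inl hx0, DCT16.mem_openConnIn_of_pathIn (PathIn.refl (Finset.mem_coe.2 hxR))⟩,
      fun hxR' => ⟨x, Or.inl hx0, DCT16.mem_openConnIn_of_pathIn (PathIn.refl (Finset.mem_coe.2 hxR'))⟩⟩
    (by
      intro u v huU hvU hPu huv
      have huv' : (zdGraph 3).Adj u v := DCT16.adj_of_openGraph_adj hω huv
      have hc0 := tiltGluing_adj_apply_le huv' 0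
      have hc1 := tiltGluing_adj_apply_le huv' 1
      have huU' := tiltGluing_mem_U.1 (Finset.mem_coe.1 huU)
      have hvU' := tiltGluing_mem_U.1 (Finset.mem_coe.1 hvU)
      refine ⟨fun hvR => ?_, fun hvR' => ?_⟩
      · -- the step ends in `R`
        have hvRc := tiltGluing_mem_R.1 hvR
        by_cases huR : u ∈ Finset.Icc (0 : Site 3) ![(h : ℤ), L, M]
        · obtain ⟨s, hs, hsu⟩ := hPu.1 huR
          exact ⟨s, hs, tiltGluing_extend hsu huv (Finset.mem_coe.2 hvR)⟩
        · -- `u ∈ U ∖ R`, so `u₁ > L` and the step lands on the plane `v₁ = L`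
          have huRc : ¬ ((0 ≤ u 0 ∧ 0 ≤ u 1 ∧ 0 ≤ u 2) ∧ (u 0 ≤ h ∧ u 1 ≤ L ∧ u 2 ≤ M)) :=
            fun hc => huR (tiltGluing_mem_R.2 hc)
          have hu1 : (L : ℤ) < u 1 := by omega
          have hv1 : v 1 = L := by omega
          by_cases hva : v 0 < a
          · exact ⟨v, Or.inr ⟨hv1, hva⟩,
              DCT16.mem_openConnIn_of_pathIn (PathIn.refl (Finset.mem_coe.2 hvR))⟩
          · -- high part of the plane: `v` is in `R'`'s target set, reached inside `R'`
            exfalso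
            have huR' : u ∈ Finset.Icc (![0, (δ : ℤ), 0] : Site 3) ![(h : ℤ), L + δ, M] :=
              tiltGluing_mem_R'.2 (by omega)
            have hvR' : v ∈ Finset.Icc (![0, (δ : ℤ), 0] : Site 3) ![(h : ℤ), L + δ, M] :=
              tiltGluing_mem_R'.2 (by omega)
            obtain ⟨s, hs, hsu⟩ := hPu.2 huR'
            obtain ⟨hsR', -, -⟩ := id hsu
            exact hR' ⟨s, Finset.mem_coe.1 hsR', v, hvR', hs, Or.inr ⟨hv1, not_lt.1 hva⟩,
              tiltGluing_extend hsu huv (Finset.mem_coe.2 hvR')⟩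
      · -- the step ends in `R'`
        have hvRc := tiltGluing_mem_R'.1 hvR'
        by_cases huR' : u ∈ Finset.Icc (![0, (δ : ℤ), 0] : Site 3) ![(h : ℤ), L + δ, M]
        · obtain ⟨s, hs, hsu⟩ := hPu.2 huR'
          exact ⟨s, hs, tiltGluing_extend hsu huv (Finset.mem_coe.2 hvR')⟩
        · -- `u ∈ U ∖ R'`, so `u₁ < δ` and the step lands on the plane `v₁ = δ`
          have huRc : ¬ ((0 ≤ u 0 ∧ (δ : ℤ) ≤ u 1 ∧ 0 ≤ u 2) ∧ (u 0 ≤ h ∧ u 1 ≤ L + δ ∧ u 2 ≤ M)) :=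
            fun hc => huR' (tiltGluing_mem_R'.2 hc)
          have hu1 : u 1 < δ := by omega
          have hv1 : v 1 = δ := by omega
          by_cases hva : v 0 < a
          · exact ⟨v, Or.inr ⟨hv1, hva⟩,
              DCT16.mem_openConnIn_of_pathIn (PathIn.refl (Finset.mem_coe.2 hvR'))⟩
          · -- high part of the plane: `v` is in `R`'s target set, reached inside `R`
            exfalso
            have huR : u ∈ Finset.Icc (0 : Site 3) ![(h : ℤ), L, M] :=
              tiltGluing_mem_R.2 (by omega)
            have hvR : v ∈ Finset.Icc (0 : Site 3) ![(h : ℤ), L, M] :=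
              tiltGluing_mem_R.2 (by omega)
            obtain ⟨s, hs, hsu⟩ := hPu.1 huR
            obtain ⟨hsR, -, -⟩ := id hsu
            exact hR ⟨s, Finset.mem_coe.1 hsR, v, hvR, hs, Or.inr ⟨hv1, not_lt.1 hva⟩,
              tiltGluing_extend hsu huv (Finset.mem_coe.2 hvR)⟩)
  -- the endpoint `y` (top face) lies in `R` or in `R'`, inside a target set: contradiction
  have hyU' := tiltGluing_mem_U.1 hyU
  by_cases hy1 : y 1 ≤ L
  · have hyR : y ∈ Finset.Icc (0 : Site 3) ![(h : ℤ), L, M] := tiltGluing_mem_R.2 (by omega)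
    obtain ⟨s, hs, hsy⟩ := key.1 hyR
    obtain ⟨hsR, -, -⟩ := id hsy
    exact hR ⟨s, Finset.mem_coe.1 hsR, y, hyR, hs, Or.inl hyh, hsy⟩
  · have hyR' : y ∈ Finset.Icc (![0, (δ : ℤ), 0] : Site 3) ![(h : ℤ), L + δ, M] :=
      tiltGluing_mem_R'.2 (by omega)
    obtain ⟨s, hs, hsy⟩ := key.2 hyR'
    obtain ⟨hsR', -, -⟩ := id hsy
    exact hR' ⟨s, Finset.mem_coe.1 hsR', y, hyR', hs, Or.inl hyh, hsy⟩

/-- **Route item `PercTiltedBlockers.TiltGluingLattice` (stmt-CriticalPhenomena-15191), proved.**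
The repaired tilt gluing lemma, stated literally as the route decl: for every lattice
configuration `ω ⊆ E(ℤ³)`, two mirror-image tilt-blocked overlapping boxes `R = Icc 0 (h,L,M)` and
`R' = Icc (0,δ,0) (h,L+δ,M)` (`δ ≤ L`) glue to a blocked box `U = Icc 0 (h,L+δ,M)`.  This is
`tiltGluing_of_subset_edgeSet` verbatim (open-reach invariant along a bottom–top open lattice path;
no cutsets, walls or intersections). [folklore] -/
theorem tiltGluingLattice_proof :
    Summit.CriticalPhenomena.PercolationContinuityZ3.Theses.PercTiltedBlockers.TiltGluingLattice := by
  unfold Summit.CriticalPhenomena.PercolationContinuityZ3.Theses.PercTiltedBlockers.TiltGluingLattice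
  exact tiltGluing_of_subset_edgeSet

end Summit.CriticalPhenomena.PercolationContinuityZ3.Theorems
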